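import Mathlib
import Literature.ModelTheory.ExponentialFields.Languages
import Literature.ModelTheory.ExponentialFields.DefinableClosure
import Literature.ModelTheory.ExponentialFields.DefinableAlgebraicNumbers
import HarnessLib
import HarnessLib.Audit

/-!
# Pointwise-definable algebraic numbers of the complex exponential field (Kirby–Macintyre–Onshuus 2012)

Topic `Literature/ModelTheory/ExponentialFields`. Grounder file (D-0014 named facts) for the
`Schanuel` route `ExceptionalSubspaces` (items `ExceptionalSubspaces.KMOTwoExistential` = stmt-Schanuel-9549,
`ExceptionalSubspaces.DefinabilityBridge` = stmt-Schanuel-9554), complementing the sibling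
`DefinableAlgebraicNumbers.lean` (which has `IsRealAbelian` with `IsRealAbelian.complex`, the automorphism
shadow of Theorem 1 and the automorphism form of Theorem 2 for Zilber fields, and explicitly leaves the
DEFINABILITY statements — Theorem 1, Theorem 2, "Theorem 2 for `ℂ_exp`" — un-vendored): this file supplies
the first-order notion of a pointwise-definable element and, with it, Theorem 1 for `ℂ_exp` (named fact)
and the open "Theorem 2 for `ℂ_exp`".

Source: J. Kirby, A. Macintyre, A. Onshuus, *The algebraic numbers definable in various exponential
fields*, J. Inst. Math. Jussieu 11 (2012) 825–834 (arXiv:1101.4224), read in full (8 pp.):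

* §2.1: in an E-field whose kernel `{x : E(x) = 1}` is infinite cyclic the field contains
  `ℚ^{ab} = ℚ(U)` (`U` = all roots of unity); `σ₀` is the involution of `ℚ^{ab}` with `σ₀(x) = x⁻¹`
  on `U`, and the **real abelian numbers** are `ℚ^{abℝ} := Fix(σ₀)` = "the unique maximal formally
  real subfield of `ℚ^{ab}`, or … the intersection of `ℚ^{ab}` with the field `ℚ^{tr}` of totally
  real numbers". Inside `ℂ`, `σ₀` is complex conjugation on `ℚ^{ab}` and `ℚ(U) = ⋃_{n ≥ 1} ℚ(e^{2πi/n})`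
  (a directed union), so `a ∈ ℚ^{abℝ}` iff `a` is real and lies in some `ℚ(e^{2πi/n})` — the form
  the route items inline; the tree's `IsRealAbelian` (`DefinableAlgebraicNumbers.lean`: `a ∈ ℚ(ζ + ζ⁻¹)`
  for a root of unity `ζ`) implies it (`IsRealAbelian.complex`, proved there).
* §1, **Theorem 1**: "For any E-field with cyclic kernel, in particular `ℂ` or the Zilber fields, all
  real abelian algebraic numbers are pointwise definable" (proof §2.2–2.7: `ℤ`, `ℚ`, `{τ, −τ}`, `cos`,
  `sin`, `π`, then `α = Σ rₙ cos(2π sₙ)`). Vendored here for the instance `ℂ_exp` named in the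
  statement: `kmo_realAbelian_pointwiseDefinable` (NAMED FACT, not proved here).
* §1, **Theorem 2**: "For the Zilber fields, the only pointwise definable algebraic numbers are the
  real abelian numbers" (proof §3.7 by extending automorphisms of `SK = ℚ^{ab}(2πi)`, §3.5 Prop.;
  §3.8: in a Zilber field with CCP an algebraic number is real abelian iff its automorphism orbit is
  a singleton). NOT vendored (it concerns Zilber's fields, not `ℂ`).
* §1, last paragraph — the OPEN QUESTION registered below as `KMOTheoremTwoComplex`: "One step towards
  Zilber's conjecture would be to show that Theorem 2 holds for the complex exponential field. One
  might hope this would be easier than the full conjecture, but we have not been able to prove it even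
  assuming Schanuel's Conjecture." Its existential fragment (parameter-free `∃`-definitions only) is
  the route item `ExceptionalSubspaces.KMOTwoExistential`; `KMOTheoremTwoComplex.of_existsDefinable`
  derives that fragment — stated with the route's inline real-abelian predicate, so that its conclusion
  is the route item verbatim — from the question via `IsRealAbelian.complex`.

"Pointwise definable" (KMO §1, §2) = definable as a singleton by a first-order formula WITHOUT
parameters in the language of exponential rings; KMO "use function symbols" (§3.5, sketch proof), i.e.
the tree's `Language.expRing = (+, ·, −, 0, 1, exp)` (`Languages.lean`), under which every
`ExponentialRing` is a structure and `ℂ` carries `Complex.exp` (`Complex.instExponentialRing`).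
`IsPointwiseDefinable` is stated in the raw one-free-variable form the route uses and is PROVED equal
to membership in the tree's definable closure of `∅` (`isPointwiseDefinable_iff_mem_definableClosure`,
via Mathlib's `Set.empty_definable_iff`). `IsPointwiseExistsDefinable` asks in addition for a prenex
existential formula (Mathlib `BoundedFormula.IsExistential`; KMO §2.2–2.4 track exactly this
`∃`/`∀` complexity of their definitions).

Nothing open is asserted: users take `(h : kmo_realAbelian_pointwiseDefinable)`; `KMOTheoremTwoComplex`
is an OPEN statement (CONVENTIONS §4), no `_holds` is to be expected.

## References

* [KirbyMacintyreOnshuus2012] J. Kirby, A. Macintyre, A. Onshuus, J. Inst. Math. Jussieu 11 (2012)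
  825–834, doi:10.1017/s1474748012000047, arXiv:1101.4224 — §1 Theorems 1–2 and closing paragraph,
  §2.1 (`ℚ^{abℝ}`), §2.7 (proof of Thm 1), §3.7–3.8 (proof of Thm 2, orbits).
* [Marker2002] D. Marker, *Model Theory: An Introduction*, Exercise 1.4.10 (definable closure).
-/

noncomputable section

open FirstOrder

namespace Literature.ModelTheory.ExponentialFields

/-! ### Pointwise definability in an exponential ring, language `(+, ·, −, 0, 1, exp)` -/

section Definable

variable (M : Type*) [Ring M] [ExponentialRing M]

/-- `a ∈ M` is **pointwise definable** (without parameters) in the exponential ring `M`, as an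
`L_exp = (+, ·, −, 0, 1, exp)`-structure: some formula `φ(x)` with one free variable and no
parameters is satisfied in `M` by `a` and by nothing else (Kirby–Macintyre–Onshuus 2012, §1–§2:
"pointwise definable"; Marker 2002, Exercise 1.4.10 with `A = ∅`). Equivalent to
`a ∈ definableClosure Language.expRing (∅ : Set M)` (`isPointwiseDefinable_iff_mem_definableClosure`).
[cite: KirbyMacintyreOnshuus2012, §1] -/
def IsPointwiseDefinable (a : M) : Prop :=
  ∃ φ : Language.expRing.Formula (Fin 1), ∀ x : M, φ.Realize ![x] ↔ x = a

/-- `a ∈ M` is **pointwise `∃`-definable** (without parameters) in the exponential ring `M`: as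
`IsPointwiseDefinable`, with a prenex existential formula (a block of `∃` in front of a
quantifier-free matrix, Mathlib's `BoundedFormula.IsExistential`). KMO §2.2–2.4 record which of
their definitions are `∃`-definitions (e.g. `ℚ = {y : (∃ z w ∈ Ker) z = w y}`; `ℤ` via Laczkovich
when some prime has a logarithm). [cite: KirbyMacintyreOnshuus2012, §2.2] -/
def IsPointwiseExistsDefinable (a : M) : Prop :=
  ∃ φ : Language.expRing.Formula (Fin 1), φ.IsExistential ∧ ∀ x : M, φ.Realize ![x] ↔ x = a

variable {M}

/-- An `∃`-definable point is definable. [cite: KirbyMacintyreOnshuus2012, §2.2] -/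
theorem IsPointwiseExistsDefinable.isPointwiseDefinable {a : M}
    (h : IsPointwiseExistsDefinable M a) : IsPointwiseDefinable M a := by
  obtain ⟨φ, -, hφ⟩ := h
  exact ⟨φ, hφ⟩

/-- The raw one-variable form agrees with the tree's definable closure over the empty parameter
set: `a` is pointwise definable iff `a ∈ dcl^{L_exp}(∅)` (Marker 2002, Exercise 1.4.10; Mathlib
`Set.empty_definable_iff`). [cite: Marker2002, Exercise 1.4.10] -/
theorem isPointwiseDefinable_iff_mem_definableClosure (a : M) :
    IsPointwiseDefinable M a ↔ a ∈ definableClosure Language.expRing (∅ : Set M) := by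
  rw [mem_definableClosure_iff, Set.Definable₁, Set.empty_definable_iff]
  constructor
  · rintro ⟨φ, hφ⟩
    refine ⟨φ, ?_⟩
    ext v
    have hv : v = ![v 0] := by
      ext i
      fin_cases i
      rfl
    simp only [Set.mem_setOf_eq, Set.mem_singleton_iff]
    rw [hv]
    simpa using (hφ (v 0)).symm
  · rintro ⟨φ, hφ⟩
    refine ⟨φ, fun x => ?_⟩
    have := Set.ext_iff.mp hφ ![x]
    simpa using this.symm

end Definable

/-! ### KMO Theorem 1 for `ℂ_exp` (named fact) and "Theorem 2 for `ℂ_exp`" (open) -/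

/-- NAMED FACT — **Kirby–Macintyre–Onshuus 2012, Theorem 1**, instance `ℂ_exp` ("For any E-field with
cyclic kernel, in particular `ℂ` or the Zilber fields, all real abelian algebraic numbers are pointwise
definable"; proof §2.7: `α ∈ ℚ^{abℝ}` is `Σ rₙ cos(2π sₙ)` with `rₙ ∈ ℤ`, `sₙ ∈ ℚ`, and `ℤ`, `ℚ`, `π`,
`cos` are parameter-free definable in `(ℂ, +, ·, exp)`, §2.2–2.5). Every real abelian number is
pointwise definable in the complex exponential field. Not proved in the tree; users take
`(h : kmo_realAbelian_pointwiseDefinable)`. [cite: KirbyMacintyreOnshuus2012, Theorem 1] -/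
def kmo_realAbelian_pointwiseDefinable : Prop :=
  ∀ a : ℂ, IsRealAbelian a → IsPointwiseDefinable ℂ a

/-- OPEN QUESTION — **"Theorem 2 for the complex exponential field"** (Kirby–Macintyre–Onshuus 2012,
§1, closing paragraph: "One step towards Zilber's conjecture would be to show that Theorem 2 holds for
the complex exponential field. One might hope this would be easier than the full conjecture, but we
have not been able to prove it even assuming Schanuel's Conjecture"; Theorem 2 = "For the Zilber
fields, the only pointwise definable algebraic numbers are the real abelian numbers"). Every algebraic
number pointwise definable in `ℂ_exp` is real abelian. It follows from Zilber's conjecture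
`ℂ_exp ≅ 𝔹` (by Theorem 2) and is incompatible with the (setwise) definability of `ℝ` in `ℂ_exp`
(KMO §1). [status: open] — registered as an open statement (CONVENTIONS §4): no `_holds` is to be
expected; users keep the explicit hypothesis. [cite: KirbyMacintyreOnshuus2012, §1 (closing paragraph) and Theorem 2] -/
@[conjecture] def KMOTheoremTwoComplex : Prop :=
  ∀ a : ℂ, IsAlgebraic ℚ a → IsPointwiseDefinable ℂ a → IsRealAbelian a

/-- The `Schanuel` route item `ExceptionalSubspaces.KMOTwoExistential` (stmt-Schanuel-9549) is the
EXISTENTIAL FRAGMENT of the open question `KMOTheoremTwoComplex` (parameter-free prenex `∃`-definitions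
only); the fragment follows from the full question. The conclusion below is that route item verbatim
(its conclusion is the route's inline real-abelian predicate, obtained from `IsRealAbelian` by the
sibling file's `IsRealAbelian.complex`; `IsPointwiseExistsDefinable ℂ a` unfolds to the route's
hypothesis by `Iff.rfl`). [cite: KirbyMacintyreOnshuus2012, §1 (closing paragraph)] -/
theorem KMOTheoremTwoComplex.of_existsDefinable (h : KMOTheoremTwoComplex) :
    ∀ a : ℂ, IsAlgebraic ℚ a → IsPointwiseExistsDefinable ℂ a →
      (a.im = 0 ∧ ∃ n : ℕ, 0 < n ∧
        a ∈ IntermediateField.adjoin ℚ ({Complex.exp (2 * Real.pi * Complex.I / n)} : Set ℂ)) :=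
  fun a ha hdef => (h a ha hdef.isPointwiseDefinable).complex

end Literature.ModelTheory.ExponentialFields

end
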